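import Summits.Ventures.PackingBounds.Energy.FivePointRieszSevenDefs
import Summits.Ventures.PackingBounds.Energy.FivePointRieszSevenBridge
import HarnessLib

/-!
# `FivePointRieszSeven`: the slack of the three-point inequality is `Σ_i m_i · (Gram form)` and nonnegative on the domain

Framing: lottery ticket; floor = certified bounds/negative ranges. Venture `PackingBounds`, cell
`pub-packcert`, energy family E3PT (pub-packcert-energy gen 12 generator `e3pt_lean_d6.py`, run by gen 17 from `code/e3pt/g17/kroute/`; KERNEL-D6 data route).
-/

noncomputable section

namespace Summit.Ventures.PackingBounds.Energy.FivePointRieszSeven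

set_option maxRecDepth 20000 in
set_option maxHeartbeats 400000000 in
/-- The slack of the three-point inequality equals `Σ_i m_i(u,v,t) · w_i(u,v,t)ᵀ Y_i w_i(u,v,t)` (`ring`). -/
theorem rexp_eqR7 (u v t : ℝ) :
    (pminKR7 u + pminKR7 v + pminKR7 t) / 3 - (c0KR7 + 3 * FexpKR7 u v t + FexpKR7 u u 1 + FexpKR7 v v 1 + FexpKR7 t t 1
      + (a1KR7 * u + a1KR7 * v + a1KR7 * t) / 3)
      = quad_1R7 (wv_1R7 u v t) := by
  unfold pminKR7 FexpKR7 c0KR7 a1KR7 quad_1R7 quad_1_0R7 quad_1_1R7 quad_1_2R7 quad_1_3R7 quad_1_4R7 quad_1_5R7 quad_1_6R7 quad_1_7R7 quad_1_8R7 quad_1_9R7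
  simp only [wv_1R7]
  ring

/-- The slack polynomial is nonnegative on the domain `D` (each multiplier `≥ 0` on `D`, each Gram block PSD). -/
theorem slack_nonnegR7 (u v t : ℝ)  :
    0 ≤ (pminKR7 u + pminKR7 v + pminKR7 t) / 3 - (c0KR7 + 3 * FexpKR7 u v t + FexpKR7 u u 1 + FexpKR7 v v 1 + FexpKR7 t t 1
      + (a1KR7 * u + a1KR7 * v + a1KR7 * t) / 3) := by
  rw [rexp_eqR7]
  exact (quad_1_nonnegR7 (wv_1R7 u v t))

end Summit.Ventures.PackingBounds.Energy.FivePointRieszSeven
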